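import Literature.IUT.HodgeArakelov.AbsTopMonoidsGenuineRmk181
import Literature.AnabelianGeometry.AbsoluteAnabelian.MonoAnalyticLiftNormCompat
import HarnessLib

/-!
# [IUTchII] Remark 1.8.1 HOLDS at the fully genuine producer — UNCONDITIONAL (proof-only; MERGE-MAP row B9 (e) closed)

S. Mochizuki, *Inter-universal Teichmüller theory II*, §1, Remark 1.8.1, kurims manuscript (Dec. 2020) pp. 41–42
[claim: Mochizuki2012, status: disputed] (IUTchII §1 Rmk 1.8.1, kurims pp.41-42): "no automorphism of `O^{×μ}(G)`
induced by an element of `Aut(G)` … coincides with an automorphism of `O^{×μ}(G)` induced by an element of `Γ` that has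
nontrivial image in `ℤ_p^×`" — for the fully genuine producer `AbsTopMonoids.genuineOfModelIsm S C ε hΔ hq` of
[IUTchII] Ex. 1.8 (`O^⊳(G) = 𝒪_k̄^⊳`, `O^⊳(σ) =` THE equivariant lift, `Ism(G)` = print's isometry group,
`Ẑ^× ↠ ℤ_p^× ↪ Ism(G)`).  abc-iut cell, layer L6, node IUTchII:Rmk1.8.1 (abc-iut-L6-t1's named `Prop`
`Rmk181_statement`, FACT-LIST F-0414); row «B9-E-RMK181-GENUINE-COND» → UNCONDITIONAL; seat abc-iut-L6-d2 (gen 5).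

The three-line composition of this seat's CONDITIONAL theorem `rmk181_genuineOfModelIsm_of_normCompat` (p430757:
`Rmk181_statement` from the single binder `hN` «the equivariant lift `liftM(φ)` preserves `N_{k/ℚ_p}` on `𝒪_k^×»`) with
abc-iut-w6-d012's discharge of that binder, `MLFClosure.norm_liftM_eq` (p433330, GAP-LEDGER G-L6d2-1: `liftM = ψ̄` on
units, `Art(ψ̄ u) = [φ h]` ([AbsAnab] Prop. 1.2.1 (iii)/(vii) row L02), `χ_p ∘ Art = N⁻¹` (`MLFReciprocityCyclotomicNorm`,
p431495), `χ_p ∘ φ = χ_p` (Prop. 1.2.1 (vi)); every input PROVED in the tree).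

* **`AbsTopMonoids.rmk181_genuineOfModelIsm : Rmk181_statement (genuineOfModelIsm S C ε hΔ hq)`** — NO hypothesis
  beyond the producer's own (H1) `hΔ` / (H2) `hq`.

HONEST FRAMING: record-only under a disputed claim key; classical content ([AbsAnab] Prop. 1.2.1 + local class field
theory + `p`-adic logarithm), all kernel-checked in the tree; nothing here bears on [IUTchIII] Cor. 3.12; typed ≠ proved
elsewhere.
-/

set_option autoImplicit false

noncomputable section

namespace Literature.IUT.HodgeArakelov

open CategoryTheory
open Literature.AnabelianGeometry.AbsoluteAnabelian

namespace AbsTopMonoids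

variable (S : ThetaSetting.{0}) (C : MLFClosure.{0}) (ε : S.Gk ≃ₜ* (ModelMLFGaloisData.galois C.k C.K).tmPair.Pi)
  (hΔ : ∀ f : S.PiX ≃ₜ* S.PiX, S.DeltaX.map f.toMulEquiv.toMonoidHom = S.DeltaX)
  (hq : Nonempty (TopGroup.quot S.PiX S.DeltaX ≃ₜ* S.Gk))

/-- **[IUTchII] Remark 1.8.1 at the fully genuine producer, UNCONDITIONALLY**: no `Aut(G)`-induced automorphism of
`O^{×μ}(G)` (`O^⊳(σ) = liftM(φ_σ)` on `(𝒪_k̄^⊳)ˣ⧸μ`) coincides with the action of a `γ ∈ Ẑ^×` with `χ_p(γ) ≠ 1` — the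
conditional theorem `rmk181_genuineOfModelIsm_of_normCompat` with its binder discharged by abc-iut-w6-d012's
`MLFClosure.norm_liftM_eq`. [claim: Mochizuki2012, status: disputed] (IUTchII §1 Rmk 1.8.1, kurims pp.41-42) -/
theorem rmk181_genuineOfModelIsm : Rmk181_statement (genuineOfModelIsm S C ε hΔ hq) := by
  haveI := C.fact_residueChar_prime
  exact rmk181_genuineOfModelIsm_of_normCompat S C ε hΔ hq (MLFClosure.norm_liftM_eq C)

end AbsTopMonoids

end Literature.IUT.HodgeArakelov

end
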